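import Summits.ValiantsHypothesis.ValiantsHypothesis.Theorems.BarrierLeverDescentCertificateSufficesBlocks

/-!
# Route BarrierLever — item `DescentCertificateSuffices` (stmt-ValiantsHypothesis-19573),
# part 2/2: the descent-certificate REDUCTION «UT-D ⇐ label-min certificate», PROVED

Closing file (`--workitem stmt-ValiantsHypothesis-19573`; cell valiant-natproofs, rung V4, 𝒟-side;
prover seat val-np-p1; statement and proof sketch by planner p1-g9, memo `HOME/p1/UTD-memo-g9.md`
§3(o)); part 1/2 (`BarrierLeverDescentCertificateSufficesBlocks.lean`) supplies the descent weight
`dwt`, the block costs `bcost`, the label sets `labels` and the block lower bound `le_bcost`.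

**The item.** A layout is a pair of maps `u, w : Fin r → Finset (Fin h)` (row / column points of
the cube). For a weight `D` on `Fin (h+h) × Fin (h+h)` the TROPICAL DETERMINANT of the block
`(x, y)` is `min_τ Σ_a D (ρ_x a) (κ_y (τ a))` (row / column literals `ρ`, `κ`), and UT-D (item 19316
`TropicalDetCertificatesExist`) asks for a `D` whose outer assignment problem
`σ ↦ Σ_j tdet(u (σ j), w j)` has a UNIQUE minimiser. HYPOTHESIS of the item (a label-min / descent
certificate): a valuation `e` of literal pairs and an assignment `π₀` fixing the common points
(`u (π₀ j) = w j` whenever the column point `w j` is a row point) whose LABEL-MIN cost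
`Σ_{j : w j not a row point} min (labels e (u (σ j)) (w j))` is STRICTLY smaller at `σ = π₀` than
at every other assignment fixing the common points. CONCLUSION: the UT-D certificate exists for
`(u, w)` (`descentCertificateSuffices`, the signature of item 19573 VERBATIM).

**Proof (memo §3(o)).** Take `B = r·E + E + 1` with `E = Σ e ≥ max e` and `D = dwt e B`.
BLOCK UPPER BOUND (`exists_bcost_eq`): a block with a mismatch has an inner assignment of cost
EXACTLY `B + min (labels e x y)` — the identity for a loop label, the increasing cycle on
`M ∪ {a, c}` (`incCycle` of the near-principal file) for a backward label `(a, c)`; with part 1's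
lower bound the tropical determinant of such a block IS `B + labelmin`, and an identity block has
tropical determinant `0`. OUTER LEMMA (`sum_inf_lt`): an assignment fixing the common points
costs `|Q|·B +` its label-min cost (`Q` = columns that are not row points), an assignment moving a
common point costs `≥ (|Q|+1)·B`, and `π₀` costs `≤ |Q|·B + |Q|·E < (|Q|+1)·B`; so the strict
label-min optimality of `π₀` makes it the unique optimal outer assignment.

WHAT THIS IS NOT: a REDUCTION only. Its intended supplier `DescentCertificatesExist` (item 19627)
is REFUTED in the tree (`…Theorems.BarrierLever.DescentFail.descentCertificatesFail`, the antipodal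
star, prover gen 6); the reduction certifies UT-D — hence TT via item 19315 — exactly on the layouts
that carry a label-min certificate (planner census: all 273 test layouts, `h ≤ 8`, `d ≤ 64`).
Nothing on UT-D in general, on TT / TNS / item 19717, on crux stmt-ValiantsHypothesis-14610, or on
`VP` versus `VNP`. Injectivity of `u`, `w` is not used.

References: planner memo `UTD-memo-g9.md` §3(o) (cell valiant-natproofs); Mulmuley–Vazirani–Vazirani
1987 (isolation of a unique optimal assignment by weights) for context.
-/

-- layout Summits/ValiantsHypothesis/ValiantsHypothesis forces the duplicated namespace component
set_option linter.dupNamespace false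

namespace Summit.ValiantsHypothesis.ValiantsHypothesis.Theorems.BarrierLever.Descent

open Finset
open Summit.ValiantsHypothesis.ValiantsHypothesis.Theorems.BarrierLever.NearPrincipal

variable {h : ℕ}

/-! ## 4. The block lemma: upper bound -/

/-- A backward label `(a, c)` is realised by the increasing cycle on `M ∪ {a, c}`. -/
theorem exists_bcost_eq_bwd (e : Fin (h + h) → Fin (h + h) → ℕ) (B : ℕ) (x y : Finset (Fin h))
    {a c : Fin h} (hca : c < a) (hub : ∀ m : Fin h, (m ∈ x ↔ m ∉ y) → m ≤ a)
    (hlb : ∀ m : Fin h, (m ∈ x ↔ m ∉ y) → c ≤ m) :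
    ∃ τ : Equiv.Perm (Fin h), bcost e B x y τ = B + e (rowL x a) (colL y c) := by
  classical
  set s : Finset (Fin h) := insert a (insert c (univ.filter (fun m => (m ∈ x ↔ m ∉ y)))) with hsdef
  have hmem_s : ∀ m, m ∈ s ↔ m = a ∨ m = c ∨ (m ∈ x ↔ m ∉ y) := fun m => by
    rw [hsdef, mem_insert, mem_insert, mem_filter]; simp only [mem_univ, true_and]
  have ha : a ∈ s := (hmem_s a).mpr (Or.inl rfl)
  have hc : c ∈ s := (hmem_s c).mpr (Or.inr (Or.inl rfl))
  have hs_le : ∀ m ∈ s, m ≤ a := fun m hm => by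
    rcases (hmem_s m).mp hm with rfl | rfl | hm'
    · exact le_rfl
    · exact hca.le
    · exact hub m hm'
  have hs_ge : ∀ m ∈ s, c ≤ m := fun m hm => by
    rcases (hmem_s m).mp hm with rfl | rfl | hm'
    · exact hca.le
    · exact le_rfl
    · exact hlb m hm'
  have hcard : s.card ≠ 0 := by
    rw [Ne, Finset.card_eq_zero]
    exact Finset.ne_empty_of_mem ha
  obtain ⟨k, hk⟩ := Nat.exists_eq_succ_of_ne_zero hcard
  set F := s.orderIsoOfFin hk with hF
  set τ := incCycle s (k + 1) hk with hτ
  refine ⟨τ, ?_⟩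
  have hFlast : ((F (Fin.last k) : s) : Fin h) = a := by
    apply le_antisymm
    · exact hs_le _ (Subtype.coe_prop _)
    · have h1 : F (F.symm ⟨a, ha⟩) ≤ F (Fin.last k) := F.monotone (Fin.le_last _)
      rw [OrderIso.apply_symm_apply] at h1
      exact h1
  have hF0 : ((F 0 : s) : Fin h) = c := by
    apply le_antisymm
    · have h1 : F 0 ≤ F (F.symm ⟨c, hc⟩) := F.monotone (Fin.zero_le _)
      rw [OrderIso.apply_symm_apply] at h1
      exact h1
    · exact hs_ge _ (Subtype.coe_prop _)
  unfold bcost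
  rw [← Finset.sum_add_sum_compl s]
  -- off `s`: agreement pairs at the identity
  have hoff : ∑ m ∈ sᶜ, dwt e B (rowL x m) (colL y (τ m)) = 0 := by
    refine Finset.sum_eq_zero (fun m hm => ?_)
    rw [Finset.mem_compl] at hm
    have hτm : τ m = m := by rw [hτ]; exact incCycle_of_not_mem s (k + 1) hk m hm
    rw [hτm]
    refine dwt_lit_agree e B x y ?_
    have hnm : ¬ (m ∈ x ↔ m ∉ y) := fun hmis => hm ((hmem_s m).mpr (Or.inr (Or.inr hmis)))
    tauto
  rw [hoff, add_zero]
  -- on `s`: forward pairs, except the last element which is paired backward with the first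
  rw [← Finset.sum_coe_sort s, ← Equiv.sum_comp F.toEquiv]
  have hstep : ∀ i : Fin (k + 1),
      dwt e B (rowL x ((F.toEquiv i : s) : Fin h)) (colL y (τ ((F.toEquiv i : s) : Fin h))) =
        if i = Fin.last k then B + e (rowL x a) (colL y c) else 0 := by
    intro i
    have h1 : τ ((F i : s) : Fin h) = ((F (finRotate (k + 1) i) : s) : Fin h) := by
      rw [hτ, hF]; exact incCycle_apply_image s (k + 1) hk i
    change dwt e B (rowL x ((F i : s) : Fin h)) (colL y (τ ((F i : s) : Fin h))) = _
    rw [h1]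
    by_cases hi : i = Fin.last k
    · rw [if_pos hi, hi, finRotate_last, hFlast, hF0]
      exact dwt_lit_bwd e B x y hca
    · rw [if_neg hi]
      have hlt : ((F i : s) : Fin h) < ((F (finRotate (k + 1) i) : s) : Fin h) := by
        rw [Subtype.coe_lt_coe, OrderIso.lt_iff_lt, lt_finRotate_iff_ne_last]
        exact hi
      exact dwt_lit_fwd e B x y hlt
  rw [Finset.sum_congr rfl (fun i _ => hstep i), Finset.sum_ite_eq' univ (Fin.last k),
    if_pos (mem_univ _)]

/-- BLOCK UPPER BOUND: a block with a mismatch has an inner assignment of cost exactly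
`B + min e(L(x, y))` (the identity for a loop label, an increasing cycle for a backward label). -/
theorem exists_bcost_eq (e : Fin (h + h) → Fin (h + h) → ℕ) (B : ℕ) (x y : Finset (Fin h))
    (hxy : x ≠ y) : ∃ τ : Equiv.Perm (Fin h), bcost e B x y τ = B + sInf (labels e x y) := by
  obtain ⟨a, c, hcond, hn⟩ := Nat.sInf_mem (labels_nonempty e x y hxy)
  change sInf (labels e x y) = e (rowL x a) (colL y c) at hn
  rw [hn]
  rcases hcond with ⟨hca, hub, hlb⟩ | ⟨hac, hM⟩
  · exact exists_bcost_eq_bwd e B x y hca hub hlb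
  · rw [← hac]
    refine ⟨1, ?_⟩
    unfold bcost
    rw [Finset.sum_eq_single a]
    · rw [Equiv.Perm.coe_one, id]
      exact dwt_lit_loop e B x y ((mismatch_iff x y a).mp ((hM a).mpr rfl))
    · intro m _ hma
      rw [Equiv.Perm.coe_one, id]
      refine dwt_lit_agree e B x y ?_
      have hm := hM m
      tauto
    · intro hna
      exact absurd (mem_univ a) hna

/-! ## 5. The outer comparison -/

/-- THE OUTER LEMMA: with `B = r·E + E + 1`, `E ≥ max e`, and `D = dwt e B`, an assignment fixing
the common points costs `|Q|·B +` its label-min cost (`Q` = columns that are not row points), an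
assignment moving a common point costs `≥ (|Q|+1)·B`, and `π₀` costs `< (|Q|+1)·B`; hence the strict
label-min optimality of `π₀` (among assignments fixing the common points) makes `π₀` the unique
optimal outer assignment for `D`. -/
theorem sum_inf_lt {r : ℕ} (u w : Fin r → Finset (Fin h)) (e : Fin (h + h) → Fin (h + h) → ℕ)
    (E : ℕ) (hE : ∀ p q, e p q ≤ E) (π₀ : Equiv.Perm (Fin r))
    (hπ₀ : ∀ j, (∃ i, u i = w j) → u (π₀ j) = w j)
    (hopt : ∀ σ : Equiv.Perm (Fin r), (∀ j, (∃ i, u i = w j) → u (σ j) = w j) → σ ≠ π₀ →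
      ∑ j ∈ univ.filter (fun j => ∀ i, u i ≠ w j), sInf (labels e (u (π₀ j)) (w j)) <
        ∑ j ∈ univ.filter (fun j => ∀ i, u i ≠ w j), sInf (labels e (u (σ j)) (w j)))
    (σ : Equiv.Perm (Fin r)) (hσ : σ ≠ π₀) :
    ∑ j, univ.inf' univ_nonempty (bcost e (r * E + E + 1) (u (π₀ j)) (w j)) <
      ∑ j, univ.inf' univ_nonempty (bcost e (r * E + E + 1) (u (σ j)) (w j)) := by
  set B := r * E + E + 1 with hBdef
  clear_value B
  have heB : ∀ p q, e p q ≤ B := fun p q => (hE p q).trans (by omega)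
  have hP : ∀ j, (¬ ∀ i, u i ≠ w j) → ∃ i, u i = w j := fun j hn => by
    by_contra hne
    exact hn (fun i hi => hne ⟨i, hi⟩)
  -- (1) upper bound for `π₀`
  have hup : ∑ j, univ.inf' univ_nonempty (bcost e B (u (π₀ j)) (w j)) ≤
      (univ.filter (fun j => ∀ i, u i ≠ w j)).card * B +
        ∑ j ∈ univ.filter (fun j => ∀ i, u i ≠ w j), sInf (labels e (u (π₀ j)) (w j)) := by
    calc ∑ j, univ.inf' univ_nonempty (bcost e B (u (π₀ j)) (w j))
        ≤ ∑ j, (if (∀ i, u i ≠ w j) then B + sInf (labels e (u (π₀ j)) (w j)) else 0) := by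
          refine sum_le_sum (fun j _ => ?_)
          by_cases hj : ∀ i, u i ≠ w j
          · rw [if_pos hj]
            obtain ⟨τ, hτ⟩ := exists_bcost_eq e B (u (π₀ j)) (w j) (hj (π₀ j))
            exact (inf'_le _ (mem_univ τ)).trans hτ.le
          · rw [if_neg hj, hπ₀ j (hP j hj)]
            exact (inf'_le _ (mem_univ 1)).trans (bcost_one_self e B (w j)).le
      _ = _ := by rw [← sum_filter, sum_add_distrib, sum_const, smul_eq_mul]
  -- (2) blocks of `σ` with a mismatch cost `≥ B + labelmin ≥ B`
  have hlowj : ∀ j, u (σ j) ≠ w j →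
      B + sInf (labels e (u (σ j)) (w j)) ≤ univ.inf' univ_nonempty (bcost e B (u (σ j)) (w j)) :=
    fun j hj => le_inf' _ _ (fun τ _ => le_bcost e B heB _ _ hj τ)
  by_cases hresp : ∀ j, (∃ i, u i = w j) → u (σ j) = w j
  · -- `σ` fixes the common points: compare the label-min costs
    have hlt := hopt σ hresp hσ
    have hlow : (univ.filter (fun j => ∀ i, u i ≠ w j)).card * B +
        ∑ j ∈ univ.filter (fun j => ∀ i, u i ≠ w j), sInf (labels e (u (σ j)) (w j)) ≤
        ∑ j, univ.inf' univ_nonempty (bcost e B (u (σ j)) (w j)) := by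
      rw [← smul_eq_mul, ← sum_const, ← sum_add_distrib, sum_filter]
      refine sum_le_sum (fun j _ => ?_)
      by_cases hj : ∀ i, u i ≠ w j
      · rw [if_pos hj]; exact hlowj j (hj (σ j))
      · rw [if_neg hj]; exact Nat.zero_le _
    omega
  · -- `σ` moves a common point: one more paying block
    obtain ⟨j₁, hj₁, hj₁'⟩ : ∃ j, (∃ i, u i = w j) ∧ u (σ j) ≠ w j := by
      by_contra hcon
      apply hresp
      intro j hj
      by_contra hne
      exact hcon ⟨j, hj, hne⟩
    have hPj₁ : ¬ ∀ i, u i ≠ w j₁ := fun hall => by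
      obtain ⟨i, hi⟩ := hj₁
      exact hall i hi
    have hlow : (univ.filter (fun j => ∀ i, u i ≠ w j)).card * B + B ≤
        ∑ j, univ.inf' univ_nonempty (bcost e B (u (σ j)) (w j)) := by
      calc (univ.filter (fun j => ∀ i, u i ≠ w j)).card * B + B
          = ∑ j, ((if (∀ i, u i ≠ w j) then B else 0) + (if j = j₁ then B else 0)) := by
            rw [sum_add_distrib, ← sum_filter, sum_const, smul_eq_mul, sum_ite_eq' univ j₁,
              if_pos (mem_univ _)]
        _ ≤ _ := by
            refine sum_le_sum (fun j _ => ?_)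
            by_cases hj : ∀ i, u i ≠ w j
            · have hjj : j ≠ j₁ := fun heq => hPj₁ (heq ▸ hj)
              rw [if_pos hj, if_neg hjj, add_zero]
              exact le_trans (Nat.le_add_right _ _) (hlowj j (hj (σ j)))
            · rw [if_neg hj, zero_add]
              by_cases hjj : j = j₁
              · rw [if_pos hjj, hjj]
                exact le_trans (Nat.le_add_right _ _) (hlowj j₁ hj₁')
              · rw [if_neg hjj]
                exact Nat.zero_le _
    have hsmall : ∑ j ∈ univ.filter (fun j => ∀ i, u i ≠ w j), sInf (labels e (u (π₀ j)) (w j)) ≤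
        r * E := by
      calc ∑ j ∈ univ.filter (fun j => ∀ i, u i ≠ w j), sInf (labels e (u (π₀ j)) (w j))
          ≤ ∑ j ∈ univ.filter (fun j => ∀ i, u i ≠ w j), E :=
            sum_le_sum (fun j _ => sInf_labels_le e _ _ E hE)
        _ = (univ.filter (fun j => ∀ i, u i ≠ w j)).card * E := by rw [sum_const, smul_eq_mul]
        _ ≤ r * E := Nat.mul_le_mul_right _ ((card_le_univ _).trans (by rw [Fintype.card_fin]))
    omega

/-! ## 6. The item, verbatim -/

/-- **Item stmt-ValiantsHypothesis-19573 `DescentCertificateSuffices`, signature VERBATIM.** If a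
valuation `e` of the literal pairs and an assignment `π₀` fixing the common points make the
label-min (descent) cost of `π₀` strictly smaller than that of every other assignment fixing the
common points, then the descent weight `D = dwt e ((r+1)·E + 1)` (`E = Σ e`) and `π₀` form a
tropical-determinant certificate for the layout `(u, w)`: `π₀` is the UNIQUE minimiser of the
outer assignment problem over the tropical determinants
`min_τ Σ_a D (ρ_{u (σ j)} a) (κ_{w j} (τ a))` — the conclusion of UT-D (item 19316) for `(u, w)`.
Injectivity of `u`, `w` is not used. -/
theorem descentCertificateSuffices :
    ∀ (h r : ℕ) (u w : Fin r → Finset (Fin h)), Function.Injective u → Function.Injective w →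
    (∃ (e : Fin (h + h) → Fin (h + h) → ℕ) (π₀ : Equiv.Perm (Fin r)),
      (∀ j, (∃ i, u i = w j) → u (π₀ j) = w j) ∧
      ∀ σ : Equiv.Perm (Fin r), (∀ j, (∃ i, u i = w j) → u (σ j) = w j) → σ ≠ π₀ →
        (∑ j ∈ Finset.univ.filter (fun j => ∀ i, u i ≠ w j),
          sInf {n : ℕ | ∃ a c : Fin h,
            ((c < a ∧ (∀ m : Fin h, (m ∈ u (π₀ j) ↔ m ∉ w j) → m ≤ a) ∧
                (∀ m : Fin h, (m ∈ u (π₀ j) ↔ m ∉ w j) → c ≤ m))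
              ∨ (a = c ∧ ∀ m : Fin h, (m ∈ u (π₀ j) ↔ m ∉ w j) ↔ m = a)) ∧
            n = e (if a ∈ u (π₀ j) then Fin.castAdd h a else Fin.natAdd h a)
                  (if c ∈ w j then Fin.natAdd h c else Fin.castAdd h c)}) <
        (∑ j ∈ Finset.univ.filter (fun j => ∀ i, u i ≠ w j),
          sInf {n : ℕ | ∃ a c : Fin h,
            ((c < a ∧ (∀ m : Fin h, (m ∈ u (σ j) ↔ m ∉ w j) → m ≤ a) ∧
                (∀ m : Fin h, (m ∈ u (σ j) ↔ m ∉ w j) → c ≤ m))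
              ∨ (a = c ∧ ∀ m : Fin h, (m ∈ u (σ j) ↔ m ∉ w j) ↔ m = a)) ∧
            n = e (if a ∈ u (σ j) then Fin.castAdd h a else Fin.natAdd h a)
                  (if c ∈ w j then Fin.natAdd h c else Fin.castAdd h c)})) →
    ∃ (D : Fin (h + h) → Fin (h + h) → ℕ) (π₀ : Equiv.Perm (Fin r)),
      ∀ σ : Equiv.Perm (Fin r), σ ≠ π₀ →
        ∑ j, Finset.univ.inf' Finset.univ_nonempty (fun τ : Equiv.Perm (Fin h) =>
          ∑ a : Fin h, D (if a ∈ u (π₀ j) then Fin.castAdd h a else Fin.natAdd h a)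
            (if τ a ∈ w j then Fin.natAdd h (τ a) else Fin.castAdd h (τ a))) <
        ∑ j, Finset.univ.inf' Finset.univ_nonempty (fun τ : Equiv.Perm (Fin h) =>
          ∑ a : Fin h, D (if a ∈ u (σ j) then Fin.castAdd h a else Fin.natAdd h a)
            (if τ a ∈ w j then Fin.natAdd h (τ a) else Fin.castAdd h (τ a))) := by
  intro h r u w _ _ hyp
  obtain ⟨e, π₀, hπ₀, hopt⟩ := hyp
  have hE : ∀ p q, e p q ≤ ∑ p', ∑ q', e p' q' := fun p q =>
    le_trans (single_le_sum (f := fun q' => e p q') (fun _ _ => Nat.zero_le _) (mem_univ q))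
      (single_le_sum (f := fun p' => ∑ q', e p' q') (fun _ _ => Nat.zero_le _) (mem_univ p))
  exact ⟨dwt e (r * (∑ p', ∑ q', e p' q') + (∑ p', ∑ q', e p' q') + 1), π₀,
    fun σ hσ => sum_inf_lt u w e _ hE π₀ hπ₀ hopt σ hσ⟩

end Summit.ValiantsHypothesis.ValiantsHypothesis.Theorems.BarrierLever.Descent
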